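import Summits.Ventures.PercRepro.RankLevelSetHallTightUp
import Summits.Ventures.PercRepro.RankLevelSetRuleQModelRecv

/-!
# PercRepro — C-044 HOLDS, IN BOTH HALL FORMS, AT THE TIGHT LAYER OF THE WHOLE MODEL FAMILY `T_p(U_{q,F} ⊕ U_{D,D})`:
THE INJECTION (♠′) IS EXPLICIT THERE (night-1, gen 15; dossier §26)

The model matroid `modelMatroid hE F q p = T_p(U_{q,F} ⊕ U_{E∖F,E∖F})` (RankLevelSetRuleQModelMatroid) is the family on which
Rule Q — the equal split — fails from `#E = 158` on (`not_ruleQUp_model`, RankLevelSetRuleQModelRecv).  The Hall form itself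
survives there, and the reason is structural: on the model **every rank-`q` set with more than `q` elements lies inside the
flat `F`** (an element outside `F` raises the rank), so the sets of `ℛ = rankqOver M p q` — the rank-`q` supersets of
members that the upward LYM count produces but `Y` does not contain — are exactly the subsets of `F` of size `q+1 … p−1`
containing a member, and they inject into the big middle sets `𝒞 = bigMid M p q` by the explicit map
`S ↦ S ∪ W(p − #S)`, where `W(j)` is one fixed `j`-subset of `E ∖ F` (`S` is recovered as `T ∩ F`; the image has `p` elements
and rank `q + (p − #S) ∈ [q+1, p−1]`).  That is the injection (♠′) of RankLevelSetHallTightUp, and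
`hallUp_of_ncard_eq_of_spade` turns it into the UP-Hall condition for every family of members; `hallDown_of_ncard_eq`
(night-1 g12) is the DOWN one.  So C-044 holds at the tight layer, in both forms, for every `q`, `k`, `m` on the whole model
family — the first infinite family beyond the kernel window `p + q ≤ 28` on which the Hall form is proved without Rule Q,
and it contains every Rule Q witness (`(72, 14, 66)`: `#E = 158`).

* `modelMatroid_subset_of_eRk_eq` — on the model a set of rank `q` with `≥ q + 1` elements lies inside `F`;
* `modelMatroid_mem_rankqOver` — the sets of ℛ on the model: inside `F`, size `q + 1 … p − 1`, and `p − #S ≤ #(E ∖ F)`;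
* **`modelMatroid_spadeInjection`** — (♠′) holds on the model at the tight layer (`#E = p + q`, `q < p`);
* **`modelMatroid_hallUp`** / **`modelMatroid_hallDown`** — the UP / DOWN Hall conditions of C-044 on the model for every
  family of members;
* `modelMatroid_hallUp_nat` / `modelMatroid_hallDown_nat` — the same on the paper's parametrisation
  `T_{q+k}(U_{q,q+m} ⊕ U_{q+k−m,q+k−m})` realised on `ℕ` (`E = Iio (2q + k)`, `F = Iio (q + m)`);
* **`exists_not_ruleQUp_and_hall`** — a finite matroid with `#E = (72 + 14) + 72` on which Rule Q FAILS while BOTH Hall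
  forms of C-044 HOLD: the cell's own Rule Q witness satisfies the Hall form.
Axioms: standard.
-/

namespace PercRepro

open Set Matroid

variable {α : Type}

/-- On the model, a set `S ⊆ E` of rank `q` with at least `q + 1` elements lies inside `F`: an element of `S` outside `F`
would make `r(S) = min(#(S ∩ F), q) + #(S ∖ F)` exceed `q` (with `q < p` the outer truncation is inactive). -/
theorem modelMatroid_subset_of_eRk_eq {E F : Set α} (hE : E.Finite) {q p : ℕ} (hqp : q < p) {S : Set α}
    (hS : S ⊆ E) (hr : (modelMatroid hE F q p).eRk S = (q : ℕ∞)) (hcard : q + 1 ≤ S.ncard) : S ⊆ F := by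
  have hSfin : S.Finite := hE.subset hS
  rw [modelMatroid_eRk hE F hqp.le hS] at hr
  have hr' : min (min (S ∩ F).ncard q + (S \ F).ncard) p = q := by exact_mod_cast hr
  have h1 := Set.ncard_inter_add_ncard_sdiff_eq_ncard S F hSfin
  have h2 : (S \ F).ncard = 0 := by omega
  rw [Set.ncard_eq_zero hSfin.sdiff] at h2
  exact Set.sdiff_eq_empty.mp h2

/-- The sets of `ℛ = rankqOver` on the model at the tight layer: inside `F`, of size `q + 1 … p − 1`, and with room for
`p − #S` further elements outside `F` (`#F ≤ q + #(Z ∩ F) ≤ q + #S` for the member `Z ⊆ S`, so `#(E ∖ F) ≥ p − #S`). -/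
theorem modelMatroid_mem_rankqOver {E F : Set α} (hE : E.Finite) (hF : F ⊆ E) {q p : ℕ} (hqp : q < p)
    (hEcard : E.ncard = p + q) {S : Set α} (hS : S ∈ rankqOver (modelMatroid hE F q p) p q) :
    S ⊆ F ∧ q + 1 ≤ S.ncard ∧ S.ncard ≤ p - 1 ∧ p - S.ncard ≤ (E \ F).ncard := by
  obtain ⟨hSE, hrS, hlo, hhi, Z, hZ, hZS⟩ := hS
  rw [modelMatroid_E] at hSE
  have hSF : S ⊆ F := modelMatroid_subset_of_eRk_eq hE hqp hSE hrS hlo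
  refine ⟨hSF, hlo, hhi, ?_⟩
  rw [modelMatroid_mem_cellMembers_iff hE hF hqp hEcard] at hZ
  obtain ⟨-, -, hFq⟩ := hZ
  have hSfin : S.Finite := hE.subset hSE
  have hFfin : F.Finite := hE.subset hF
  have hZF : (Z ∩ F).ncard ≤ S.ncard := Set.ncard_le_ncard (inter_subset_left.trans hZS) hSfin
  have hEF : (E \ F).ncard = E.ncard - F.ncard := Set.ncard_sdiff hF hFfin
  have hFE : F.ncard ≤ E.ncard := Set.ncard_le_ncard hF hE
  omega

/-- For `S ⊆ F` and `W ⊆ E ∖ F`: `(S ∪ W) ∩ F = S`. -/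
theorem union_inter_eq_of_subset_of_subset_sdiff {E F S W : Set α} (hSF : S ⊆ F) (hW : W ⊆ E \ F) :
    (S ∪ W) ∩ F = S := by
  ext x
  constructor
  · rintro ⟨hx1, hx2⟩
    rcases hx1 with hxS | hxW
    · exact hxS
    · exact absurd hx2 (hW hxW).2
  · intro hxS
    exact ⟨Or.inl hxS, hSF hxS⟩

/-- For `S ⊆ F` and `W ⊆ E ∖ F`: `(S ∪ W) ∖ F = W`. -/
theorem union_sdiff_eq_of_subset_of_subset_sdiff {E F S W : Set α} (hSF : S ⊆ F) (hW : W ⊆ E \ F) :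
    (S ∪ W) \ F = W := by
  ext x
  constructor
  · rintro ⟨hx1, hx2⟩
    rcases hx1 with hxS | hxW
    · exact absurd (hSF hxS) hx2
    · exact hxW
  · intro hxW
    exact ⟨Or.inr hxW, (hW hxW).2⟩

/-- **(♠′) holds on the model at the tight layer** (`#E = p + q`, `q < p`, `F ⊆ E`): the rank-`q` supersets of members
inject into the big middle sets by `S ↦ S ∪ W(p − #S)`, with `W(j)` one fixed `j`-subset of `E ∖ F` — `S` is recovered as
`(S ∪ W) ∩ F`, the image has `p` elements and rank `q + (p − #S)`, strictly between `q` and `p`. -/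
theorem modelMatroid_spadeInjection {E F : Set α} (hE : E.Finite) (hF : F ⊆ E) {q p : ℕ} (hqp : q < p)
    (hEcard : E.ncard = p + q) : SpadeInjection (modelMatroid hE F q p) p q := by
  classical
  have hDfin : (E \ F).Finite := hE.sdiff
  have hW : ∀ j : ℕ, j ≤ (E \ F).ncard → ∃ W : Set α, W ⊆ E \ F ∧ W.ncard = j :=
    fun j hj => Set.exists_subset_card_eq hj
  choose! W hW using hW
  refine ⟨fun S => S ∪ W (p - S.ncard), ?_, ?_⟩
  · intro S₁ hS₁ S₂ hS₂ hEq
    obtain ⟨hS₁F, -, -, hj₁⟩ := modelMatroid_mem_rankqOver hE hF hqp hEcard hS₁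
    obtain ⟨hS₂F, -, -, hj₂⟩ := modelMatroid_mem_rankqOver hE hF hqp hEcard hS₂
    have e1 := union_inter_eq_of_subset_of_subset_sdiff hS₁F (hW _ hj₁).1
    have e2 := union_inter_eq_of_subset_of_subset_sdiff hS₂F (hW _ hj₂).1
    simp only at hEq
    rw [← e1, ← e2, hEq]
  · intro S hS
    obtain ⟨hSF, hlo, hhi, hj⟩ := modelMatroid_mem_rankqOver hE hF hqp hEcard hS
    obtain ⟨hWD, hWcard⟩ := hW _ hj
    have hSE : S ⊆ E := hSF.trans hF
    have hSfin : S.Finite := hE.subset hSE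
    have hWfin : (W (p - S.ncard)).Finite := hDfin.subset hWD
    have hdisj : Disjoint S (W (p - S.ncard)) := by
      rw [Set.disjoint_left]
      intro x hxS hxW
      exact (hWD hxW).2 (hSF hxS)
    have hTE : S ∪ W (p - S.ncard) ⊆ E := union_subset hSE (hWD.trans Set.sdiff_subset)
    have hTF := union_inter_eq_of_subset_of_subset_sdiff hSF hWD
    have hTD := union_sdiff_eq_of_subset_of_subset_sdiff hSF hWD
    have hTcard : (S ∪ W (p - S.ncard)).ncard = p := by
      rw [Set.ncard_union_eq hdisj hSfin hWfin, hWcard]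
      omega
    have hrk : (modelMatroid hE F q p).eRk (S ∪ W (p - S.ncard)) = ((q + (p - S.ncard) : ℕ) : ℕ∞) := by
      rw [modelMatroid_eRk hE F hqp.le hTE, hTF, hTD, hWcard]
      rw [show min (min S.ncard q + (p - S.ncard)) p = q + (p - S.ncard) by omega]
    refine ⟨⟨hTE, ?_, ?_, ?_⟩, subset_union_left⟩
    · rw [hrk]
      exact_mod_cast (show q < q + (p - S.ncard) by omega)
    · rw [hrk]
      exact_mod_cast (show q + (p - S.ncard) < p by omega)
    · rw [hTcard]

/-- **C-044, UP FORM, ON THE MODEL** (every `q < p`, `F ⊆ E`, `#E = p + q`): every family `𝒜` of members of the cell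
`(p, q)` of `T_p(U_{q,F} ⊕ U_{E∖F,E∖F})` has at least `Φ(p,q)·#𝒜` UP-neighbours. -/
theorem modelMatroid_hallUp {E F : Set α} (hE : E.Finite) (hF : F ⊆ E) {q p : ℕ} (hqp : q < p)
    (hEcard : E.ncard = p + q) (𝒜 : Set (Set α)) (h𝒜 : 𝒜 ⊆ cellMembers (modelMatroid hE F q p) p q) :
    phiK p q * (𝒜.ncard : ℚ) ≤ ((upNbhd (modelMatroid hE F q p) p q 𝒜).ncard : ℚ) := by
  haveI := modelMatroid_finite hE F q p
  exact hallUp_of_ncard_eq_of_spade (modelMatroid hE F q p) p q (by rw [modelMatroid_E]; exact hEcard)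
    (modelMatroid_spadeInjection hE hF hqp hEcard) 𝒜 h𝒜

/-- **C-044, DOWN FORM, ON THE MODEL** (night-1 g12's `hallDown_of_ncard_eq`, instantiated). -/
theorem modelMatroid_hallDown {E F : Set α} (hE : E.Finite) {q p : ℕ}
    (hEcard : E.ncard = p + q) (𝒜 : Set (Set α)) (h𝒜 : 𝒜 ⊆ cellMembers (modelMatroid hE F q p) p q) :
    phiK p q * (𝒜.ncard : ℚ) ≤ ((downNbhd (modelMatroid hE F q p) p q 𝒜).ncard : ℚ) := by
  haveI := modelMatroid_finite hE F q p
  exact hallDown_of_ncard_eq (M := modelMatroid hE F q p) p q (by rw [modelMatroid_E]; exact hEcard) 𝒜 h𝒜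

/-- `#(Iio n) = n` in `ℕ` (as in RankLevelSetRuleQModelRecv). -/
lemma ncard_Iio_nat' (n : ℕ) : (Set.Iio n).ncard = n := by
  rw [← Finset.coe_range, Set.ncard_coe_finset, Finset.card_range]

/-- **The paper's family `T_{q+k}(U_{q,q+m} ⊕ U_{q+k−m,q+k−m})` on `ℕ`** (`E = Iio (2q + k)`, `F = Iio (q + m)`, `m ≤ q`,
`k ≥ 1`): the UP-Hall condition of C-044 at the tight layer of the cell `(q + k, q)` for every family of members. -/
theorem modelMatroid_hallUp_nat (q k m : ℕ) (hk : 1 ≤ k) (hm : m ≤ q) (𝒜 : Set (Set ℕ))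
    (h𝒜 : 𝒜 ⊆ cellMembers (modelMatroid (Set.finite_Iio (q + k + q)) (Set.Iio (q + m)) q (q + k)) (q + k) q) :
    phiK (q + k) q * (𝒜.ncard : ℚ) ≤
      ((upNbhd (modelMatroid (Set.finite_Iio (q + k + q)) (Set.Iio (q + m)) q (q + k)) (q + k) q 𝒜).ncard : ℚ) :=
  modelMatroid_hallUp (Set.finite_Iio (q + k + q)) (Set.Iio_subset_Iio (by omega)) (by omega)
    (ncard_Iio_nat' _) 𝒜 h𝒜

/-- The same for the DOWN form. -/
theorem modelMatroid_hallDown_nat (q k m : ℕ) (𝒜 : Set (Set ℕ))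
    (h𝒜 : 𝒜 ⊆ cellMembers (modelMatroid (Set.finite_Iio (q + k + q)) (Set.Iio (q + m)) q (q + k)) (q + k) q) :
    phiK (q + k) q * (𝒜.ncard : ℚ) ≤
      ((downNbhd (modelMatroid (Set.finite_Iio (q + k + q)) (Set.Iio (q + m)) q (q + k)) (q + k) q 𝒜).ncard : ℚ) :=
  modelMatroid_hallDown (Set.finite_Iio (q + k + q)) (ncard_Iio_nat' _) 𝒜 h𝒜

/-- **The Rule Q witness satisfies C-044 in both Hall forms**: a finite matroid with `#E = (72 + 14) + 72` on which Rule Q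
fails at the tight layer of the cell `(86, 72)` (`not_ruleQUp_model`, RankLevelSetRuleQModelRecv) while every family of
members has at least `Φ(86,72)·#𝒜` UP-neighbours and at least `Φ(86,72)·#𝒜` DOWN-neighbours — the equal split is what
fails, not the Hall form. (Here it is `T₈₆(U_{72,138} ⊕ U_{20,20})` on `ℕ`.) -/
theorem exists_not_ruleQUp_and_hall :
    ∃ (α : Type) (M : Matroid α) (hf : M.Finite),
      M.E.ncard = (72 + 14) + 72 ∧ ¬ @RuleQUp α M hf (72 + 14) 72 ∧
      (∀ 𝒜 ⊆ cellMembers M (72 + 14) 72,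
        phiK (72 + 14) 72 * (𝒜.ncard : ℚ) ≤ ((upNbhd M (72 + 14) 72 𝒜).ncard : ℚ)) ∧
      (∀ 𝒜 ⊆ cellMembers M (72 + 14) 72,
        phiK (72 + 14) 72 * (𝒜.ncard : ℚ) ≤ ((downNbhd M (72 + 14) 72 𝒜).ncard : ℚ)) := by
  have hE : (Set.Iio (72 + 14 + 72) : Set ℕ).Finite := Set.finite_Iio _
  have hFE : Set.Iio (72 + 66) ⊆ Set.Iio (72 + 14 + 72) := Set.Iio_subset_Iio (by norm_num)
  have hEcard : (Set.Iio (72 + 14 + 72) : Set ℕ).ncard = (72 + 14) + 72 := ncard_Iio_nat' _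
  refine ⟨ℕ, modelMatroid hE (Set.Iio (72 + 66)) 72 (72 + 14), modelMatroid_finite hE _ _ _, ?_, ?_, ?_, ?_⟩
  · rw [modelMatroid_E, hEcard]
  · intro hRQ
    have hZF : Set.Iio 72 ⊆ Set.Iio (72 + 66) := Set.Iio_subset_Iio (by norm_num)
    have hFcard : (Set.Iio (72 + 66) : Set ℕ).ncard = 72 + 66 := ncard_Iio_nat' _
    have hZmem : Set.Iio 72 ∈ cellMembers (modelMatroid hE (Set.Iio (72 + 66)) 72 (72 + 14)) (72 + 14) 72 := by
      rw [modelMatroid_mem_cellMembers_iff hE hFE (by norm_num) hEcard]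
      refine ⟨hZF.trans hFE, ncard_Iio_nat' _, ?_⟩
      rw [Set.inter_eq_left.2 hZF, hFcard, ncard_Iio_nat' 72]
      norm_num
    have h1 := hRQ _ hZmem
    rw [modelMatroid_ruleQRecv_eq hE hFE (by norm_num) hEcard (by rw [hFcard]; norm_num) (by rw [hFcard]; norm_num)
      hZF (ncard_Iio_nat' _), hFcard] at h1
    exact absurd h1 (not_le.mpr rhat_lt_phiK_72_14_66)
  · intro 𝒜 h𝒜
    exact modelMatroid_hallUp hE hFE (by norm_num) hEcard 𝒜 h𝒜
  · intro 𝒜 h𝒜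
    exact modelMatroid_hallDown hE hEcard 𝒜 h𝒜

end PercRepro
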